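/-
Copyright (c) 2026 the pub-hodgecm-mathlib formalisation cell (harness21).  Prover seat hodgecm-mathlib-A-p03 (g26); road «R1LL-tree» (architect A-p16 (g27), RULING A-16 (b);
LEAD F0P3a-plan (g10)), brick I-5a-ram FILE C «vertex frames of rank-2 unitary elements without a `σ`-fixed uniformiser», 2026-09-01.
-/
import Literature.NumberTheory.Automorphic.UnitaryCompactElementVertexLattice   -- ★ I-5a FILES A∕B (g25): eigenframe Gram algebra, `GL₂(𝒪)` bookkeeping, the inert transvection ∕ double root
import HarnessLib

/-!
# Vertex frames of rank-2 unitary elements WITHOUT a `σ`-fixed uniformiser (the tamely RAMIFIED shapes)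

Generic linear algebra over a field `K` with an involution `σ` and (from §2 on) a `ValuativeRel` — FILE C of brick «I-5a-ram», the ramified twin of ★
`UnitaryCompactElementVertexLattice` (g25).  At a RAMIFIED quadratic place there is no `σ`-fixed uniformiser (`σ`-fixed elements have even valuation, an
anti-fixed uniformiser `η`, `ση = −η`, exists at a tame place ★ `RamifiedPlaceAntiFixedUniformizer`), so the three frames of ★ FILE B that used `σϖ = ϖ` are
re-cut here under the weaker hypothesis **`σ(ϖ·ϖ) = ϖ·ϖ`** (true for `σϖ = ±ϖ`) or none at all:
* §1 (field level) the CYCLIC FRAME of a rootless `γ ∈ U(σ, Φ₂)` rescaled by an arbitrary scalar `c`: `P = c • (e₀ | γe₀)`, `P⁻¹γP` the companion matrix,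
  Gram `antidiag(β, σβ)` with `β = σ(c)·c·γ₁₀` (`σ(σ(c)c) = σ(c)c` for an involution — no `σc = c` needed);
* §2 (valued) its normalisation `v(β) = v(ϖ^e)`, `e ∈ {0,1}`, for ANY `ϖ` generating the value group (`exists_cyclicFrame_companion_antidiag_valuation`), and
  `antidiag(β, σβ) = ϖ^e • ↑J′`, `J′ = antidiag(βϖ^{−e}, σ(β)ϖ^{−e}) ∈ GL₂(𝒪)` (`exists_mem_glInt_smul_coe_eq_antidiag_of_valuation_eq`; ★ g25's needed `σϖ = ϖ`);
* §3 the unitary TRANSVECTION ∕ scalar and the DOUBLE ROOT fix a SELF-DUAL vertex (`…_of_map_mul_self`): ★ g25's proofs verbatim with the `σ`-fixed rescaling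
  `π = (ϖϖ)^k` in place of `ϖ^k` — adapted from ★ `UnitaryCompactElementVertexLattice` :61–:225;
* §4 the ELLIPTIC type-(1) frame (`γP = P·diag(u)`, `u` injective of norm one): the Gram matrix is `diag(d)`, `dᵢ` `σ`-fixed ≠ 0 (★ `twistGram_eigenframe_eq_diagonal`);
  if every `σ`-fixed `a ≠ 0` rescales to a unit (`v(σ(c)·a·c) = 1` — at a ramified place: EVEN valuation) then `Λ(P·diag(c))` has a UNIMODULAR diagonal Gram
  matrix: at a ramified place the elliptic type-(1) torus fixes a SELF-DUAL lattice (colour `e = 0`; [LabesseLanglands1979, §2 p. 8]: `E¹ × E¹` fixes an edge midpoint).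

Topic `NumberTheory/Automorphic`; namespace `Literature.NumberTheory.Automorphic`.  THEOREMS ONLY (no definition, no instance, no notation, no named fact, no `sorry`);
kernel lane.  Cell `pub/hodgecm-mathlib`, F0∕P3a, crux H413 (stmt-HodgeConjecture-24833), road «R1LL-tree» ramified branch (MEMO-R1ram §2–§4, B-p12 census (U1)).
HONEST LABEL: HC_CM is proved only modulo the printed citations until rung 0 closes — nothing printed is asserted here (explicit `2 × 2` matrix algebra).

## References
* [Serre1980Trees] J.-P. Serre, *Trees* (1980), Ch. II §1.2–§1.3.  * [Jacobowitz1962] R. Jacobowitz, *Hermitian forms over local fields*, Amer. J. Math. 84 (1962), §5, §7–§8.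
* [Rogawski1990] J. D. Rogawski, *Automorphic Representations of Unitary Groups in Three Variables* (1990): §3.1 p. 19, §3.5 p. 29, §3.6 p. 31, §4.9 p. 56.
* [LabesseLanglands1979] J.-P. Labesse, R. P. Langlands, *L-indistinguishability for SL(2)*, Canad. J. Math. 31 (1979), §2 pp. 8–10.
* [BruhatTits1972] F. Bruhat, J. Tits, *Groupes réductifs sur un corps local I*, Publ. IHÉS 41 (1972), §10 (rank one; barycentric subdivision at a ramified place).
-/

set_option autoImplicit false

noncomputable section

open scoped ValuativeRel Matrix MatrixGroups
open Matrix ValuativeRel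
open Literature.AlgebraicGeometry.ShimuraVarieties (unitaryGroup mem_unitaryGroup_iff)
open Literature.NumberTheory.Rogawski1990 (twistGram twistGram_def twistGram_mul twistGram_unitary_mul conjTranspose_twistGram det_twistGram
  twistGram_eigenframe_eq_diagonal map_twistGram_apply_self twistGram_eigenframe_apply_ne_zero)

namespace Literature.NumberTheory.Automorphic

variable {K : Type*} [Field K] (σ : K →+* K)

/-! ## §1 The rescaled cyclic frame of a rootless unitary element (field level, `σ` an involution) -/

section CyclicField
/-- **THE RESCALED CYCLIC FRAME.**  `σ` an involution, `γ ∈ U(σ, Φ₂)` (`Φ₂ = antidiag(1,1)`) with ROOTLESS `χ_γ`, `c ≠ 0` any scalar: `P := c • (e₀ | γe₀)` is invertible,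
`P⁻¹γP = [[0, −det γ], [1, tr γ]]` (★ `mul_cyclicFrame_eq_mul_companion`) and `ᵗσ(P) Φ₂ P = antidiag(β, σβ)` with `β = σ(c)·c·γ₁₀ ≠ 0` (★ `formCongr_cyclicFrame_eq_antidiag`;
`σ(σ(c)c·γ₁₀) = σ(c)c·σ(γ₁₀)` since `σ² = 1` — no `σ`-fixedness of `c` is used). [cite: Rogawski1990, §3.6 p. 31] [cite: Serre1980Trees, Ch. II §1.2] -/
theorem exists_cyclicFrame_companion_antidiag_smul (hσσ : ∀ x, σ (σ x) = x) {c : K} (hc : c ≠ 0) (γ : GL (Fin 2) K)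
    (hγ : γ ∈ unitaryGroup σ (Matrix.of fun i j : Fin 2 => if i.val + j.val + 1 = 2 then (1 : K) else 0))
    (hirr : ¬ ∃ x : K, ((γ : Matrix (Fin 2) (Fin 2) K).charpoly).IsRoot x) :
    ∃ P : GL (Fin 2) K,
      (((P⁻¹ * γ * P : GL (Fin 2) K)) : Matrix (Fin 2) (Fin 2) K) = !![0, -(γ : Matrix (Fin 2) (Fin 2) K).det; 1, (γ : Matrix (Fin 2) (Fin 2) K).trace] ∧
      formCongr σ P (Matrix.of fun i j : Fin 2 => if i.val + j.val + 1 = 2 then (1 : K) else 0) =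
        !![0, σ c * c * (γ : Matrix (Fin 2) (Fin 2) K) 1 0; σ (σ c * c * (γ : Matrix (Fin 2) (Fin 2) K) 1 0), 0] ∧
      σ c * c * (γ : Matrix (Fin 2) (Fin 2) K) 1 0 ≠ 0 := by
  have h10 : (γ : Matrix (Fin 2) (Fin 2) K) 1 0 ≠ 0 := UnitaryGroup.apply_one_zero_ne_zero_of_not_exists_isRoot _ hirr
  have hAu := mem_unitaryGroup_iff.1 hγ
  have hσc : σ c ≠ 0 := (map_ne_zero σ).2 hc
  have hPdet : (c • (!![1, (γ : Matrix (Fin 2) (Fin 2) K) 0 0; 0, (γ : Matrix (Fin 2) (Fin 2) K) 1 0] : Matrix (Fin 2) (Fin 2) K)).det ≠ 0 := by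
    rw [Matrix.det_smul, Matrix.det_fin_two, Fintype.card_fin]
    simp only [of_apply, cons_val', cons_val_zero, cons_val_one, cons_val_fin_one, empty_val', one_mul, mul_zero, sub_zero]
    exact mul_ne_zero (pow_ne_zero _ hc) h10
  let P : GL (Fin 2) K := Matrix.GeneralLinearGroup.mkOfDetNeZero _ hPdet
  have hP : (P : Matrix (Fin 2) (Fin 2) K) = c • !![1, (γ : Matrix (Fin 2) (Fin 2) K) 0 0; 0, (γ : Matrix (Fin 2) (Fin 2) K) 1 0] := rfl
  have hcomp : (γ : Matrix (Fin 2) (Fin 2) K) * (c • !![1, (γ : Matrix (Fin 2) (Fin 2) K) 0 0; 0, (γ : Matrix (Fin 2) (Fin 2) K) 1 0]) =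
      (c • !![1, (γ : Matrix (Fin 2) (Fin 2) K) 0 0; 0, (γ : Matrix (Fin 2) (Fin 2) K) 1 0]) *
        !![0, -(γ : Matrix (Fin 2) (Fin 2) K).det; 1, (γ : Matrix (Fin 2) (Fin 2) K).trace] := by
    rw [Matrix.mul_smul, Matrix.smul_mul, UnitaryGroup.mul_cyclicFrame_eq_mul_companion]
  refine ⟨P, ?_, ?_, mul_ne_zero (mul_ne_zero hσc hc) h10⟩
  · rw [Units.val_mul, Units.val_mul, hP]
    have hinv : ((P⁻¹ : GL (Fin 2) K) : Matrix (Fin 2) (Fin 2) K) * (c • !![1, (γ : Matrix (Fin 2) (Fin 2) K) 0 0; 0, (γ : Matrix (Fin 2) (Fin 2) K) 1 0]) = 1 := by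
      rw [← hP]; exact Units.inv_mul P
    rw [Matrix.mul_assoc, hcomp, ← Matrix.mul_assoc, hinv, Matrix.one_mul]
  · have hms : ((c • (!![1, (γ : Matrix (Fin 2) (Fin 2) K) 0 0; 0, (γ : Matrix (Fin 2) (Fin 2) K) 1 0] : Matrix (Fin 2) (Fin 2) K)).map σ) =
        σ c • (!![1, (γ : Matrix (Fin 2) (Fin 2) K) 0 0; 0, (γ : Matrix (Fin 2) (Fin 2) K) 1 0] : Matrix (Fin 2) (Fin 2) K).map σ :=
      Matrix.map_smul' _ _ _ (fun a b => map_mul σ a b)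
    rw [formCongr, hP, hms, Matrix.transpose_smul, Matrix.smul_mul, Matrix.smul_mul, Matrix.mul_smul, UnitaryGroup.formCongr_cyclicFrame_eq_antidiag σ hAu, smul_smul,
      map_mul, map_mul, hσσ]
    ext i j
    fin_cases i <;> fin_cases j <;> simp [mul_comm, mul_left_comm]
end CyclicField

/-! ## §2 Over a valued field: the normalised cyclic frame and the `ϖ^e`-rescaled antidiagonal Gram matrix, no `σ`-fixed uniformiser -/

section CyclicValued
variable [ValuativeRel K]

/-- **THE NORMALISED CYCLIC FRAME for ANY generator `ϖ` of the value group.**  `σ` a valuation-preserving involution, `γ ∈ U(σ, Φ₂)` with rootless `χ_γ`, `ϖ ≠ 0` with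
`v(x) ∈ v(ϖ)^ℤ` for all `x ≠ 0` (a uniformiser — NOT assumed `σ`-fixed): there are `P`, `β ≠ 0`, `e ∈ {0,1}` with `P⁻¹γP = [[0, −det γ], [1, tr γ]]`,
`ᵗσ(P) Φ₂ P = antidiag(β, σβ)` and `v(β) = v(ϖ^e)` (`P = ϖ^{−m} • (e₀ | γe₀)`, `β = σ(ϖ^{−m})ϖ^{−m}γ₁₀`, `v(γ₁₀) = v(ϖ^{2m+e})`).  Ramified twin of ★
`exists_cyclicFrame_ncard_selfDualStable_eq_of_uniformizer` (which takes `σϖ = ϖ`). [cite: Rogawski1990, §3.6 p. 31] [cite: Jacobowitz1962, §8] -/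
theorem exists_cyclicFrame_companion_antidiag_valuation (hσσ : ∀ x, σ (σ x) = x) (hσv : ∀ x, valuation K (σ x) = valuation K x)
    {ϖ : K} (hϖ0 : ϖ ≠ 0) (hunif : ∀ x : K, x ≠ 0 → ∃ k : ℤ, valuation K x = valuation K (ϖ ^ k)) (γ : GL (Fin 2) K)
    (hγ : γ ∈ unitaryGroup σ (Matrix.of fun i j : Fin 2 => if i.val + j.val + 1 = 2 then (1 : K) else 0))
    (hirr : ¬ ∃ x : K, ((γ : Matrix (Fin 2) (Fin 2) K).charpoly).IsRoot x) :
    ∃ (P : GL (Fin 2) K) (β : K) (e : ℕ), β ≠ 0 ∧ e ≤ 1 ∧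
      (((P⁻¹ * γ * P : GL (Fin 2) K)) : Matrix (Fin 2) (Fin 2) K) = !![0, -(γ : Matrix (Fin 2) (Fin 2) K).det; 1, (γ : Matrix (Fin 2) (Fin 2) K).trace] ∧
      formCongr σ P (Matrix.of fun i j : Fin 2 => if i.val + j.val + 1 = 2 then (1 : K) else 0) = !![0, β; σ β, 0] ∧
      valuation K β = valuation K (ϖ ^ e) := by
  have h10 : (γ : Matrix (Fin 2) (Fin 2) K) 1 0 ≠ 0 := UnitaryGroup.apply_one_zero_ne_zero_of_not_exists_isRoot _ hirr
  obtain ⟨k, hk⟩ := hunif _ h10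
  obtain ⟨m, e, he1, hme⟩ : ∃ (m : ℤ) (e : ℕ), e ≤ 1 ∧ k = 2 * m + (e : ℤ) := by
    rcases Int.emod_two_eq_zero_or_one k with h | h
    · exact ⟨k / 2, 0, zero_le_one, by omega⟩
    · exact ⟨k / 2, 1, le_rfl, by omega⟩
  have hc : ϖ ^ (-m) ≠ 0 := zpow_ne_zero _ hϖ0
  obtain ⟨P, hcomp, hform, hβ⟩ := exists_cyclicFrame_companion_antidiag_smul σ hσσ hc γ hγ hirr
  refine ⟨P, σ (ϖ ^ (-m)) * ϖ ^ (-m) * (γ : Matrix (Fin 2) (Fin 2) K) 1 0, e, hβ, he1, hcomp, hform, ?_⟩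
  rw [map_mul, map_mul, hσv, hk, ← map_mul, ← map_mul, ← zpow_add₀ hϖ0, ← zpow_natCast, ← zpow_add₀ hϖ0]
  congr 2
  omega

/-- **The `ϖ^e`-rescaled antidiagonal Gram matrix without `σϖ = ϖ`**: `|β| = |ϖ^e|`, `σ` valuation-preserving ⟹ `antidiag(β, σβ) = ϖ^e • ↑J′` with
`J′ = antidiag(β ϖ^{−e}, σ(β) ϖ^{−e}) ∈ GL₂(𝒪)` (unit entries, unit determinant).  Ramified twin of ★ `exists_mem_glInt_smul_coe_eq_antidiag`.
[cite: Jacobowitz1962, §8] [cite: Rogawski1990, §3.6 p. 31] -/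
theorem exists_mem_glInt_smul_coe_eq_antidiag_of_valuation_eq (hσv : ∀ x, valuation K (σ x) = valuation K x) {ϖ : K} (hϖ0 : ϖ ≠ 0) {β : K} {e : ℕ}
    (hβ : valuation K β = valuation K (ϖ ^ e)) :
    ∃ J' ∈ glInt 2 K, ϖ ^ e • (J' : Matrix (Fin 2) (Fin 2) K) = !![0, β; σ β, 0] := by
  obtain ⟨π, hπ⟩ : ∃ π : K, π = ϖ ^ e := ⟨_, rfl⟩
  have hπ0 : π ≠ 0 := by rw [hπ]; exact pow_ne_zero e hϖ0
  rw [← hπ] at hβ ⊢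
  have hvπ0 : valuation K π ≠ 0 := (Valuation.ne_zero_iff _).2 hπ0
  have hb1 : valuation K (β * π⁻¹) = 1 := by
    rw [map_mul, map_inv₀, hβ, mul_inv_cancel₀ hvπ0]
  have hσb1 : valuation K (σ β * π⁻¹) = 1 := by
    rw [map_mul, map_inv₀, hσv, hβ, mul_inv_cancel₀ hvπ0]
  have hbO : β * π⁻¹ ∈ 𝒪[K] := (Valuation.mem_integer_iff _ _).2 hb1.le
  have hσbO : σ β * π⁻¹ ∈ 𝒪[K] := (Valuation.mem_integer_iff _ _).2 hσb1.le
  have hb0 : β * π⁻¹ ≠ 0 := fun h => by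
    rw [h, map_zero] at hb1
    exact zero_ne_one hb1
  have hσb0 : σ β * π⁻¹ ≠ 0 := fun h => by
    rw [h, map_zero] at hσb1
    exact zero_ne_one hσb1
  have hdet : (!![0, β * π⁻¹; σ β * π⁻¹, 0] : Matrix (Fin 2) (Fin 2) K).det ≠ 0 := by
    rw [Matrix.det_fin_two_of, zero_mul, zero_sub, neg_ne_zero]
    exact mul_ne_zero hb0 hσb0
  refine ⟨Matrix.GeneralLinearGroup.mkOfDetNeZero _ hdet, mem_glInt_of_isIntegralMatrix (fun i j => ?_) ?_, ?_⟩
  · rw [Matrix.GeneralLinearGroup.val_mkOfDetNeZero]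
    fin_cases i <;> fin_cases j
    · exact (𝒪[K]).zero_mem
    · exact hbO
    · exact hσbO
    · exact (𝒪[K]).zero_mem
  · rw [Matrix.GeneralLinearGroup.val_mkOfDetNeZero, Matrix.det_fin_two_of, zero_mul, zero_sub, Valuation.map_neg, map_mul, hb1, hσb1, mul_one]
  · rw [Matrix.GeneralLinearGroup.val_mkOfDetNeZero]
    have hc : ∀ y, π * (y * π⁻¹) = y := fun y => by rw [mul_comm, inv_mul_cancel_right₀ hπ0]
    ext i j
    fin_cases i <;> fin_cases j <;> simp [hc]
end CyclicValued

/-! ## §3 The unitary transvection and the double root, rescaled by the `σ`-FIXED square `ϖϖ` -/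

section Vertex
variable [ValuativeRel K] {ϖ : K} (hϖ : IsUniformizingElement ϖ)

include hϖ in
/-- **A UNITARY TRANSVECTION (OR SCALAR) FIXES A SELF-DUAL VERTEX — no `σ`-fixed uniformiser.**  `γ ∈ U(σ, Φ₂)`, `↑γ = c • 1 + n`, `n² = 0`, `|c| = 1`, `σ` an involution
with `σ(ϖϖ) = ϖϖ` (`σϖ = ±ϖ`), `𝒪` a DVR ⟹ `∃ g, ᵗσ(g) Φ₂ g = Φ₂ ∧ g⁻¹ γ g ∈ GL₂(𝒪)`.  ★ g25's proof with the rescaling `g = (v₀ | w) · diag(π⁻¹, π)`, `π = (ϖϖ)^k`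
(`σπ = π`), `k ≫ 0`.  -- adapted from ★ `UnitaryCompactElementVertexLattice.exists_formCongr_eq_and_mem_glInt_of_mul_self_eq_zero`
[cite: Serre1980Trees, Ch. II §1.3] [cite: LabesseLanglands1979, §2 p. 9] [cite: Jacobowitz1962, §8] -/
theorem exists_formCongr_eq_and_mem_glInt_of_mul_self_eq_zero_of_map_mul_self [IsDiscreteValuationRing 𝒪[K]] (hσσ : ∀ x, σ (σ x) = x)
    (hσϖ : σ (ϖ * ϖ) = ϖ * ϖ)
    {γ : GL (Fin 2) K} (hγ : γ ∈ unitaryGroup σ (Matrix.of fun i j : Fin 2 => if i.val + j.val + 1 = 2 then (1 : K) else 0))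
    {c : K} (hc : valuation K c = 1) {n : Matrix (Fin 2) (Fin 2) K} (hn2 : n * n = 0)
    (hγn : (γ : Matrix (Fin 2) (Fin 2) K) = c • (1 : Matrix (Fin 2) (Fin 2) K) + n) :
    ∃ g : GL (Fin 2) K, formCongr σ g (Matrix.of fun i j : Fin 2 => if i.val + j.val + 1 = 2 then (1 : K) else 0) =
        (Matrix.of fun i j : Fin 2 => if i.val + j.val + 1 = 2 then (1 : K) else 0) ∧ g⁻¹ * γ * g ∈ glInt 2 K := by
  classical
  have hϖ0 : ϖ ≠ 0 := hϖ.ne_zero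
  have hcO : c ∈ 𝒪[K] := (Valuation.mem_integer_iff _ _).2 hc.le
  rcases eq_or_ne n 0 with hn | hn
  · refine ⟨1, by rw [formCongr, Units.val_one, Matrix.map_one σ (map_zero σ) (map_one σ), transpose_one, Matrix.one_mul, Matrix.mul_one], ?_⟩
    rw [inv_one, one_mul, mul_one]
    refine mem_glInt_of_isIntegralMatrix (fun i j => ?_) ?_
    · rw [hγn, hn, add_zero, Matrix.smul_apply, smul_eq_mul]
      rcases eq_or_ne i j with rfl | hij
      · rw [Matrix.one_apply_eq, mul_one]
        exact hcO
      · rw [Matrix.one_apply_ne hij, mul_zero]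
        exact (𝒪[K]).zero_mem
    · rw [hγn, hn, add_zero, Matrix.det_smul, Matrix.det_one, mul_one, Fintype.card_fin, map_pow, hc, one_pow]
  · obtain ⟨i₀, j₀, hij₀⟩ : ∃ i j, n i j ≠ 0 := by
      by_contra h
      push Not at h
      exact hn (Matrix.ext fun i j => h i j)
    obtain ⟨v₀, hv₀e⟩ : ∃ v₀ : Fin 2 → K, v₀ = fun i => n i j₀ := ⟨_, rfl⟩
    have hv₀ : v₀ ≠ 0 := fun h0 => hij₀ (by
      have h := congrFun h0 i₀
      rw [hv₀e] at h
      exact h)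
    have hnv₀ : n *ᵥ v₀ = 0 := by
      rw [hv₀e]
      funext i
      have h := congrFun (congrFun hn2 i) j₀
      rw [Matrix.mul_apply] at h
      exact h
    have hu := form_mulVec_eq_of_mem_unitaryGroup σ hγ
    rw [hγn] at hu
    have hiso := Literature.LinearAlgebra.HermitianPlane.form_eq_zero_of_unitary_transvection σ hσσ c hn hn2 hu hv₀ hnv₀
    rw [map_one, mul_one, mul_one] at hiso
    obtain ⟨g₀, hg₀det, hg₀form, hg₀col⟩ : ∃ g₀ : Matrix (Fin 2) (Fin 2) K, g₀.det ≠ 0 ∧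
        (g₀.map σ)ᵀ * (Matrix.of fun i j : Fin 2 => if i.val + j.val + 1 = 2 then (1 : K) else 0) * g₀ =
          (Matrix.of fun i j : Fin 2 => if i.val + j.val + 1 = 2 then (1 : K) else 0) ∧ g₀ *ᵥ ![1, 0] = v₀ := by
      rcases eq_or_ne (v₀ 1) 0 with hq | hq
      · have hp : v₀ 0 ≠ 0 := fun hp => hv₀ (by
          funext i
          fin_cases i
          · exact hp
          · exact hq)
        have hσp : σ (v₀ 0) ≠ 0 := (map_ne_zero σ).2 hp
        refine ⟨!![v₀ 0, 0; 0, (σ (v₀ 0))⁻¹], ?_, ?_, ?_⟩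
        · rw [Matrix.det_fin_two_of, zero_mul, sub_zero]
          exact mul_ne_zero hp (inv_ne_zero hσp)
        · ext i j
          fin_cases i <;> fin_cases j <;> simp [Matrix.mul_apply, Fin.sum_univ_two, hσσ, hp, hσp]
        · funext i
          fin_cases i
          · simp [Matrix.mulVec, dotProduct, Fin.sum_univ_two]
          · simp [Matrix.mulVec, dotProduct, Fin.sum_univ_two, hq]
      · have hσq : σ (v₀ 1) ≠ 0 := (map_ne_zero σ).2 hq
        have hq0 : σ (v₀ 1) * v₀ 0 = -(σ (v₀ 0) * v₀ 1) := by linear_combination hiso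
        refine ⟨!![v₀ 0, (σ (v₀ 1))⁻¹; v₀ 1, 0], ?_, ?_, ?_⟩
        · rw [Matrix.det_fin_two_of, mul_zero, zero_sub, neg_ne_zero]
          exact mul_ne_zero (inv_ne_zero hσq) hq
        · ext i j
          fin_cases i <;> fin_cases j <;> simp [Matrix.mul_apply, Fin.sum_univ_two, hσσ, hq, hσq, hq0]
        · funext i
          fin_cases i <;> simp [Matrix.mulVec, dotProduct, Fin.sum_univ_two]
    obtain ⟨G₀, hG₀⟩ : ∃ G : GL (Fin 2) K, (G : Matrix (Fin 2) (Fin 2) K) = g₀ :=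
      ⟨Matrix.GeneralLinearGroup.mkOfDetNeZero g₀ hg₀det, Matrix.GeneralLinearGroup.val_mkOfDetNeZero _ _⟩
    have hXg : ((G₀⁻¹ : GL (Fin 2) K) : Matrix (Fin 2) (Fin 2) K) * g₀ = 1 := by
      rw [← hG₀, ← Units.val_mul, inv_mul_cancel, Units.val_one]
    have hgX : g₀ * ((G₀⁻¹ : GL (Fin 2) K) : Matrix (Fin 2) (Fin 2) K) = 1 := by
      rw [← hG₀, ← Units.val_mul, mul_inv_cancel, Units.val_one]
    obtain ⟨n', hn'⟩ : ∃ n' : Matrix (Fin 2) (Fin 2) K, n' = ((G₀⁻¹ : GL (Fin 2) K) : Matrix (Fin 2) (Fin 2) K) * n * g₀ := ⟨_, rfl⟩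
    have hconj : (((G₀⁻¹ * γ * G₀ : GL (Fin 2) K)) : Matrix (Fin 2) (Fin 2) K) = c • (1 : Matrix (Fin 2) (Fin 2) K) + n' := by
      rw [Units.val_mul, Units.val_mul, hγn, hG₀, Matrix.mul_add, Matrix.add_mul, Matrix.mul_smul, Matrix.mul_one, Matrix.smul_mul, hXg, hn']
    have hn'2 : n' * n' = 0 := by
      rw [hn']
      calc ((G₀⁻¹ : GL (Fin 2) K) : Matrix (Fin 2) (Fin 2) K) * n * g₀ * (((G₀⁻¹ : GL (Fin 2) K) : Matrix (Fin 2) (Fin 2) K) * n * g₀)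
          = ((G₀⁻¹ : GL (Fin 2) K) : Matrix (Fin 2) (Fin 2) K) * (n * ((g₀ * ((G₀⁻¹ : GL (Fin 2) K) : Matrix (Fin 2) (Fin 2) K)) * n)) * g₀ := by
            simp only [Matrix.mul_assoc]
        _ = 0 := by rw [hgX, Matrix.one_mul, hn2, Matrix.mul_zero, Matrix.zero_mul]
    have hn'v : n' *ᵥ ![1, 0] = 0 := by
      rw [hn', ← Matrix.mulVec_mulVec, ← Matrix.mulVec_mulVec, hg₀col, hnv₀, Matrix.mulVec_zero]
    have hcol : ∀ i, n' i 0 = 0 := fun i => by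
      have h := congrFun hn'v i
      simpa [Matrix.mulVec, dotProduct, Fin.sum_univ_two] using h
    have h11 : n' 1 1 = 0 := by
      have h := congrFun (congrFun hn'2 1) 1
      rw [Matrix.mul_apply, Fin.sum_univ_two, hcol 1, zero_mul, zero_add, Matrix.zero_apply] at h
      exact mul_self_eq_zero.1 h
    have hM₁ : c • (1 : Matrix (Fin 2) (Fin 2) K) + n' = !![c, n' 0 1; 0, c] := by
      ext i j
      fin_cases i <;> fin_cases j <;> simp [hcol 0, hcol 1, h11]
    -- the rescaling exponent: `π = (ϖϖ)^k` with `π n′₀₁ π ∈ 𝒪`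
    obtain ⟨k, hk⟩ : ∃ k : ℕ, (ϖ * ϖ) ^ k * n' 0 1 * (ϖ * ϖ) ^ k ∈ 𝒪[K] := by
      rcases eq_or_ne (n' 0 1) 0 with hx | hx
      · exact ⟨0, by rw [hx, mul_zero, zero_mul]; exact (𝒪[K]).zero_mem⟩
      · obtain ⟨m, hm⟩ := exists_valuation_eq_valuation_zpow hϖ hx
        refine ⟨m.natAbs, (Valuation.mem_integer_iff _ _).2 ?_⟩
        have hϖϖ : (ϖ * ϖ) ^ m.natAbs = ϖ ^ ((m.natAbs : ℤ) + (m.natAbs : ℤ)) := by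
          rw [mul_pow, ← pow_add, ← zpow_natCast]
          push_cast
          ring_nf
        rw [map_mul, map_mul, hm, hϖϖ, ← map_mul, ← map_mul, ← zpow_add₀ hϖ0, ← zpow_add₀ hϖ0]
        exact (Valuation.mem_integer_iff _ _).1 ((zpow_uniformizer_mem_integer_iff hϖ _).2 (by omega))
    obtain ⟨π, hπ⟩ : ∃ π : K, π = (ϖ * ϖ) ^ k := ⟨_, rfl⟩
    rw [← hπ] at hk
    have hπ0 : π ≠ 0 := by rw [hπ]; exact pow_ne_zero k (mul_ne_zero hϖ0 hϖ0)
    have hσπ : σ π = π := by rw [hπ, map_pow, hσϖ]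
    have hDdet : (diagonal ![π⁻¹, π]).det ≠ 0 := by
      rw [det_diagonal, Fin.prod_univ_two]
      simp [hπ0]
    obtain ⟨D, hD⟩ : ∃ D : GL (Fin 2) K, (D : Matrix (Fin 2) (Fin 2) K) = diagonal ![π⁻¹, π] :=
      ⟨Matrix.GeneralLinearGroup.mkOfDetNeZero _ hDdet, Matrix.GeneralLinearGroup.val_mkOfDetNeZero _ _⟩
    have hDinv : ((D⁻¹ : GL (Fin 2) K) : Matrix (Fin 2) (Fin 2) K) = diagonal ![π, π⁻¹] := by
      rw [Matrix.coe_units_inv, hD]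
      refine Matrix.inv_eq_left_inv ?_
      rw [diagonal_mul_diagonal]
      ext i j
      fin_cases i <;> fin_cases j <;> simp [hπ0]
    refine ⟨G₀ * D, ?_, ?_⟩
    · rw [formCongr_mul]
      show (((D : Matrix (Fin 2) (Fin 2) K)).map σ)ᵀ *
          ((((G₀ : Matrix (Fin 2) (Fin 2) K)).map σ)ᵀ * (Matrix.of fun i j : Fin 2 => if i.val + j.val + 1 = 2 then (1 : K) else 0) *
            (G₀ : Matrix (Fin 2) (Fin 2) K)) * (D : Matrix (Fin 2) (Fin 2) K) = _
      rw [hG₀, hg₀form, hD, diagonal_map (map_zero σ), diagonal_transpose]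
      ext i j
      fin_cases i <;> fin_cases j <;> simp [Matrix.mul_apply, Fin.sum_univ_two, hσπ, hπ0]
    · have hval : (((G₀ * D)⁻¹ * γ * (G₀ * D) : GL (Fin 2) K) : Matrix (Fin 2) (Fin 2) K) = !![c, π * n' 0 1 * π; 0, c] := by
        rw [show (G₀ * D)⁻¹ * γ * (G₀ * D) = D⁻¹ * (G₀⁻¹ * γ * G₀) * D by group, Units.val_mul, Units.val_mul, hconj, hM₁, hDinv, hD]
        have h1 : ∀ y, π * y * π⁻¹ = y := fun y => by rw [mul_comm π y, mul_inv_cancel_right₀ hπ0]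
        have h2 : ∀ y, π⁻¹ * y * π = y := fun y => by rw [mul_comm π⁻¹ y, inv_mul_cancel_right₀ hπ0]
        ext i j
        fin_cases i <;> fin_cases j <;> simp [Matrix.mul_apply, Fin.sum_univ_two, h1, h2]
      refine mem_glInt_of_isIntegralMatrix (fun i j => ?_) ?_
      · rw [hval]
        fin_cases i <;> fin_cases j
        · exact hcO
        · exact hk
        · exact (𝒪[K]).zero_mem
        · exact hcO
      · rw [hval, Matrix.det_fin_two_of, mul_zero, sub_zero, map_mul, hc, mul_one]

include hϖ in
/-- **THE DOUBLE ROOT — no `σ`-fixed uniformiser.**  `γ ∈ U(σ, Φ₂)`, `|det γ| = 1`, `χ_γ` with a root but NOT separable: `χ_γ = (X − α)²`, `|α| = 1`, `(γ − α)² = 0`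
(Cayley–Hamilton) — a scalar or a unitary transvection, hence fixes a self-dual vertex (§3, `σ(ϖϖ) = ϖϖ`).  -- adapted from ★ `…of_not_separable` (g25)
[cite: Serre1980Trees, Ch. II §1.3] [cite: LabesseLanglands1979, §2 p. 9] -/
theorem exists_formCongr_eq_and_mem_glInt_of_not_separable_of_map_mul_self [IsDiscreteValuationRing 𝒪[K]] (hσσ : ∀ x, σ (σ x) = x)
    (hσϖ : σ (ϖ * ϖ) = ϖ * ϖ)
    {γ : GL (Fin 2) K} (hγ : γ ∈ unitaryGroup σ (Matrix.of fun i j : Fin 2 => if i.val + j.val + 1 = 2 then (1 : K) else 0))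
    (hdet : valuation K (γ : Matrix (Fin 2) (Fin 2) K).det = 1) {α : K} (hα : ((γ : Matrix (Fin 2) (Fin 2) K).charpoly).IsRoot α)
    (hsep : ¬ ((γ : Matrix (Fin 2) (Fin 2) K).charpoly).Separable) :
    ∃ g : GL (Fin 2) K, formCongr σ g (Matrix.of fun i j : Fin 2 => if i.val + j.val + 1 = 2 then (1 : K) else 0) =
        (Matrix.of fun i j : Fin 2 => if i.val + j.val + 1 = 2 then (1 : K) else 0) ∧ g⁻¹ * γ * g ∈ glInt 2 K := by
  obtain ⟨α', hfac⟩ := UnitaryGroup.exists_eq_X_sub_C_mul_X_sub_C_of_isRoot (Matrix.charpoly_monic _)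
    (by rw [Matrix.charpoly_natDegree_eq_dim, Fintype.card_fin]) hα
  have hαα' : α = α' := by
    by_contra hne
    exact hsep (by
      rw [hfac]
      exact Polynomial.separable_X_sub_C.mul Polynomial.separable_X_sub_C
        (Polynomial.isCoprime_X_sub_C_of_isUnit_sub (sub_ne_zero.2 hne).isUnit))
  subst hαα'
  have hdetα : (γ : Matrix (Fin 2) (Fin 2) K).det = α * α := by
    rw [Matrix.det_eq_sign_charpoly_coeff, hfac, Fintype.card_fin, Polynomial.mul_coeff_zero]
    simp
  have hαv : valuation K α = 1 := valuation_eq_one_of_mul_self_eq hdetα.symm hdet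
  have hCH : ((γ : Matrix (Fin 2) (Fin 2) K) - α • 1) * ((γ : Matrix (Fin 2) (Fin 2) K) - α • 1) = 0 := by
    have h := Matrix.aeval_self_charpoly (γ : Matrix (Fin 2) (Fin 2) K)
    rwa [hfac, map_mul, map_sub, Polynomial.aeval_X, Polynomial.aeval_C, Algebra.algebraMap_eq_smul_one] at h
  exact exists_formCongr_eq_and_mem_glInt_of_mul_self_eq_zero_of_map_mul_self σ hϖ hσσ hσϖ hγ hαv hCH (add_sub_cancel _ _).symm
end Vertex

/-! ## §4 The elliptic type-(1) frame: a unimodular DIAGONAL Gram matrix when `σ`-fixed scalars rescale to units -/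

section Elliptic
variable [ValuativeRel K]

/-- **A diagonal matrix with unit entries is `↑J′` for some `J′ ∈ GL₂(𝒪)`.** [cite: Serre1980Trees, Ch. II §1.2] -/
theorem exists_mem_glInt_coe_eq_diagonal_of_valuation_eq_one {d : Fin 2 → K} (hd : ∀ i, valuation K (d i) = 1) :
    ∃ J' ∈ glInt 2 K, (J' : Matrix (Fin 2) (Fin 2) K) = diagonal d := by
  have hd0 : ∀ i, d i ≠ 0 := fun i h0 => by
    have h := hd i
    rw [h0, map_zero] at h
    exact zero_ne_one h
  have hdet : (diagonal d).det ≠ 0 := by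
    rw [det_diagonal, Fin.prod_univ_two]
    exact mul_ne_zero (hd0 0) (hd0 1)
  exact ⟨Matrix.GeneralLinearGroup.mkOfDetNeZero _ hdet,
    mem_glInt_of_coe_eq_diagonal_of_valuation_eq_one (Matrix.GeneralLinearGroup.val_mkOfDetNeZero _ hdet) hd,
    Matrix.GeneralLinearGroup.val_mkOfDetNeZero _ hdet⟩

/-- **THE ELLIPTIC TYPE-(1) TORUS FIXES A SELF-DUAL LATTICE when `σ`-fixed scalars rescale to units.**  `H` `σ`-hermitian with `det H ≠ 0`, `σ` an involution,
`γ ∈ U(σ, H)` with an eigenframe `γP = P·diag(u)`, `u` injective of norm one (`σ(uᵢ)uᵢ = 1`): the Gram matrix of the frame is `diag(d)` with `σ`-fixed `dᵢ ≠ 0`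
(★ `twistGram_eigenframe_eq_diagonal`, ★ `map_twistGram_apply_self`, ★ `twistGram_eigenframe_apply_ne_zero`); if every `σ`-fixed `a ≠ 0` admits `c` with `v(σ(c)·a·c) = 1`
(hypothesis `hsq` — at a tamely RAMIFIED place: `σ`-fixed ⇒ even valuation), then for `D = diag(c)` the Gram matrix of `P·D` is a UNIT diagonal matrix `↑J′`, `J′ ∈ GL₂(𝒪)`:
`Λ(PD)` is SELF-DUAL.  (At an inert place one gets `ϖ^e • 1` instead, ★ `exists_rescaling_formCongr_eq_uniformizer_pow_smul_one`.)
[cite: LabesseLanglands1979, §2 p. 8] [cite: Jacobowitz1962, §5] [cite: Rogawski1990, §3.6 p. 31] -/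
theorem exists_diagonal_formCongr_coe_eq_of_rescale (hσσ : ∀ x, σ (σ x) = x) {H : Matrix (Fin 2) (Fin 2) K} (hH : (H.map σ)ᵀ = H) (hH0 : H.det ≠ 0)
    {γ P : GL (Fin 2) K} {u : Fin 2 → K} (hγ : γ ∈ unitaryGroup σ H) (hP : (γ : Matrix (Fin 2) (Fin 2) K) * P = P * diagonal u)
    (hu : Function.Injective u) (hu1 : ∀ i, σ (u i) * u i = 1)
    (hsq : ∀ a : K, a ≠ 0 → σ a = a → ∃ c : K, valuation K (σ c * a * c) = 1) :
    ∃ (D : GL (Fin 2) K) (c : Fin 2 → K), (D : Matrix (Fin 2) (Fin 2) K) = diagonal c ∧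
      ∃ J' ∈ glInt 2 K, (J' : Matrix (Fin 2) (Fin 2) K) = formCongr σ (P * D) H := by
  set d : Fin 2 → K := fun i => twistGram σ H P.val i i with hd
  have hHP : twistGram σ H P.val = diagonal d := twistGram_eigenframe_eq_diagonal σ H hγ hP hu hu1
  have hdfix : ∀ i, σ (d i) = d i := fun i => map_twistGram_apply_self σ H hσσ hH P.val i
  have hd0 : ∀ i, d i ≠ 0 := fun i => twistGram_eigenframe_apply_ne_zero σ H hH0 hγ hP hu hu1 i
  choose c hc using fun i => hsq (d i) (hd0 i) (hdfix i)
  have hc0 : ∀ i, c i ≠ 0 := fun i h0 => by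
    have h := hc i
    rw [h0, mul_zero, map_zero] at h
    exact zero_ne_one h
  have hDdet : (diagonal c).det ≠ 0 := by
    rw [det_diagonal, Fin.prod_univ_two]
    exact mul_ne_zero (hc0 0) (hc0 1)
  obtain ⟨D, hD⟩ : ∃ D : GL (Fin 2) K, (D : Matrix (Fin 2) (Fin 2) K) = diagonal c :=
    ⟨Matrix.GeneralLinearGroup.mkOfDetNeZero _ hDdet, Matrix.GeneralLinearGroup.val_mkOfDetNeZero _ _⟩
  have hform : formCongr σ (P * D) H = diagonal fun i => σ (c i) * d i * c i := formCongr_mul_diagonal_of_eq_diagonal σ P D H hHP hD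
  obtain ⟨J', hJ', hJ'e⟩ := exists_mem_glInt_coe_eq_diagonal_of_valuation_eq_one (d := fun i => σ (c i) * d i * c i) hc
  exact ⟨D, c, hD, J', hJ', by rw [hJ'e, hform]⟩
end Elliptic

end Literature.NumberTheory.Automorphic

end
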